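import Literature.MathematicalPhysics.QuantumFieldTheory.Balaban1983to89.B7Prop5CplxLevels

/-!
# `Balaban1983to89.B7Prop5Cplx` — T. Bałaban, *Averaging operations for lattice gauge theories*, Commun. Math. Phys. **98** (1985)
17–51 [Balaban1985Averaging]: **PROPOSITION 5 EXTENDED TO THE COMPLEX BACKGROUND `U′U₀`, UNIFORMLY IN `A′`** (p. 43 «Similarly,
Proposition 5 may be extended to include analyticity and uniformity statements. The formulations are obvious.») — file 5/5: the
assembly: (147), (157), (156) for `Q_j(U′U₀, ηA)`, `j ≤ k`, PER BOND, k-UNIFORM, with constants independent of `U′`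

statement-level skeleton of published theorems with citation tags; proofs where landed; nothing here is a claim about the Yang–Mills mass gap

PDF held: `paper:balaban1985-cmp98-averaging` (journal page = PDF page + 16); pp. 39–43 [PDF 23–27] ((137)–(157), Props. 5–7)
read from the materialised text layer `~/.lit/texts/paper-balaban1985-cmp98-averaging/p0023.txt`–`p0027.txt`.

CITATION HEADER / WHAT IS REPRODUCED.  SKELETON row **B7.Prop7** (cell `lit-balaban`, HOME `run/shared/lean/pub/lit-balaban/`, seat
p06 gen 4 = unit `lit-balaban-p06`; B7 owner r04 (successor item (i) of its gen-4 HANDOFF), referee ref-4) — the located qualifier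
of ROWS-B7 v3.7 «the Prop. 5 extension (‘Similarly, Proposition 5 may be extended …’) not typed».  p. 42 (Prop. 5): *"The
functional derivative of Q_k(U₀, ηA) is a bounded function for α₀, α₁ sufficiently small, and we have the bounds |(δ/δA_b)Q_k(U₀,
ηA, c)| ≦ 1 + 2C′₁α₀ + C₃|A| < 1 + 2C′₁α₀ + C₃α₁, (156) |(δ/δA_b)C_k(U₀, A, c)| ≦ C₃|A| < C₃α₁. (157)"*; p. 43: *"Proposition 7.
For U₀ satisfying (52) and U′ = e^{iηA′}, |A′| < α₁, α₀, α₁ sufficiently small, the function Q_k(U′U₀, ηA) is analytic in complex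
variables A′, A, and Proposition 4 holds uniformly in A′. Similarly, Proposition 5 may be extended to include analyticity and
uniformity statements. The formulations are obvious."*

THE OBVIOUS FORMULATION, TYPED AND PROVED.  For `U₀` satisfying (52) (`G`-valued, `G ⊂ U1` averaging-closed, `C₀α₀ ≤ 1/3`, `8α₀ ≤
c₂′`), `U′ = e^{B′}` with `sup‖B′‖ ≤ b′` in the Prop.-7 regime, and the field `B = ηA`, `sup‖B‖ ≤ b`, every `j ≤ k`, every unit-lattice
bond `b = ⟨y, y + e_μ⟩`, `X ∈ 𝔸`, every bond `c` of the `j`-th lattice: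
 (147)  `‖LʲηQ_j(U′U₀)(Xδ_b)(c)‖ ≤ (1 + ϑ·Lʲ/Lᵏ)·Lʲ·L^{−jd}·‖X‖`, zero unless `b ⊂ Bʲ(c₋) ∪ Bʲ(c₊)`;
 (157)  `B″ ↦ C_j(U′U₀, B″)(c)` differentiable at `B` along `Xδ_b`, `‖dC_j(B; Xδ_b)(c)‖ ≤ C₃·(Lʲ)²·L^{−jd}·b·‖X‖`, zero unless
        `b ⊂ Bʲ(c₋) ∪ Bʲ(c₊)`;
 (156)  `B″ ↦ Q_j(U′U₀, ηB″)(c)` differentiable at `B` along `Xδ_b` with derivative of norm `≤ ((1 + ϑ·Lʲ/Lᵏ)·Lʲ + C₃(Lʲ)²b)·L^{−jd}·‖X‖`,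
with `ϑ = thetaCplx d L α₀ k b′ = 8(ε_k + τ_k)` (print's «2C′₁α₀», now `O(1)(α₀ + Lᵏb′)` — depends on the SIZE `b′` of `B′`, not on
`B′`: «uniformly in A′») and `C₃ = C3Cplx d L` (independent of `U′`, `j`, `k`), under the displayed smallness «α₀, α₁ sufficiently
small»: `ε_k ≤ 1/16`, `d·(ε_k + τ_k) ≤ 1/16`, `d·C₃·Lᵏb ≤ 1` (besides the Prop.-7 regime of `B7Prop7Levels`).

THE PRINTED ROUTE, FOLLOWED (files 1–4, then here).  (139) at the complex level backgrounds `Ũ′ʲŪ₀ʲ` (file 1 `B7Ineq139Cplx`, three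
terms: transport excess `ε_j`, `Q″`-coefficient `τ_j`) → (143)–(147) (file 2 `B7Prop5CplxLinear`, cumulative `Θ_j` under the step
condition (145)ⱼ) → (148) at `Ũ′ʲŪ₀ʲ` (file 4) → (149)–(155) (file 3 `B7Prop5CplxInduction`, under (155)ⱼ) → (156)/(157); file 4
`B7Prop5CplxLevels` discharges every one-step binder at `avgIter L (e^{B′}U₀) j` from r04's `B7Prop7Levels` level data.  THIS FILE:
§1 the level sequences are geometric — `ε_j = (Lʲ/Lᵏ)·ε_k`, `τ_j ≤ (Lʲ/Lᵏ)·τ_k` — and the cumulative coefficient is chosen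
`Θ_j := ϑ·Lʲ/Lᵏ`; §2 the two step conditions (145)ⱼ / (155)ⱼ FOLLOW from the displayed smallness for every `j < k` and every `L ≥ 2`
(`step143_arith`, `step149_arith`: elementary real arithmetic — print's «this change is easily incorporated into the considerations and
the estimates … for α₀, α₁ sufficiently small»); §3 the assembly.

WHAT THIS FILE PROVES (kernel, 0 sorry, standard axioms): `thetaCplx` (def) and signs; `epsCplx_level`, `tauCplx_level_le`,
`step143_arith`, `step149_arith`, `hstep143_cplx_levels`, `hstep149_cplx_levels`; **`prop5_cplx_147_uniform`** ((147) at `U′U₀` +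
locality), **`prop5_cplx_157_uniform`** ((157) at `U′U₀` + locality), **`prop5_cplx_156_uniform`** ((156) at `U′U₀`); §4 at `j = k`
IN THE PRINTED VARIABLES `A`, `η = L^{−k}`: **`prop5_cplx_157_printed`** (`|dC_k(U′U₀, A; Xδ_b)(c)| ≤ C₃|A|·η^d|X|`),
**`prop5_cplx_156_printed`** (`|dQ_k(U′U₀, ηA; Xδ_b)(c)| ≤ (1 + ϑ + C₃|A|)·η^d|X|` — VERBATIM SHAPE of (156) with «2C′₁α₀ ↦ ϑ»).
HONEST DIVERGENCES (located): as in files 1–4 (constants are admissible explicit witnesses of print's `O(1)`/«sufficiently small»,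
`d`- and `L`-dependent, not optimal; per-bond bookkeeping; `<` ↦ `≤`; `ℤᵈ`, corner blocks, `U1`/`AvgClosed`); the analyticity
half of the sentence («analyticity … statements») is Prop. 7's joint analyticity of `Q_k(U′U₀, ηA)` in `(A′, A)`
(`B7Prop7Levels.prop7_analyticAt`, `B7Prop7Ins.prop7_analyticOnNhd_ins`, r04), from which the derivative (156) inherits analyticity;
not re-typed here.
-/

noncomputable section

open scoped BigOperators
open NormedSpace Finset Metric Set

namespace Literature.MathematicalPhysics.QuantumFieldTheory.Balaban1983to89.B7Prop5Cplx

open B7Prop1Explicit B7Prop1Local B7Prop2Explicit B7Prop3Flat B7Prop4Flat B7Prop5Flat B7Eq92Concrete B7Prop3GeneralLinear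
  B7Prop4GeneralLevels B7Ineq148 B7Prop5GeneralOperators B7Prop5GeneralInduction B7Prop5CplxLinear B7Prop5CplxInduction
  B7Prop5CplxLevels B7Prop7Levels

-- `Site` alone would resolve to the torus sites of `Setup.lean`; re-export the `ℤ^d` sites of `B7Prop1Explicit`.
export B7Prop1Explicit (Site)

variable {d : ℕ}

/-! ## §1 The level sequences are geometric; the cumulative coefficient `Θ_j = ϑ·Lʲ/Lᵏ` -/

/-- print's «1 + 2C′₁α₀» at the complex background: the cumulative coefficient `ϑ = 8(ε_k + τ_k)` of `Q″_k` in (146)/(156) for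
`Q_k(U′U₀)` — `O(1)(α₀ + α₁)` with constants depending on `d`, `L` only («uniformly in A′»: through the size `b′ = ηα₁` of `A′`).
[cite: Balaban1985Averaging, (146)–(147) p.40, Prop. 5 (156) p.42, Proposition 7 p.43] -/
def thetaCplx (d L : ℕ) (α₀ : ℝ) (k : ℕ) (b' : ℝ) : ℝ := 8 * (epsCplx d L b' k + tauCplx d L α₀ k b' k)

/-- `thetaCplx ≥ 0`. [cite: Balaban1985Averaging, Proposition 7 p.43] -/
theorem thetaCplx_nonneg (d L : ℕ) {α₀ : ℝ} (hα : 0 ≤ α₀) (k : ℕ) {b' : ℝ} (hb' : 0 ≤ b') : 0 ≤ thetaCplx d L α₀ k b' := by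
  have := epsCplx_nonneg d L hb' k
  have := tauCplx_nonneg d L hα k hb' k
  unfold thetaCplx; positivity

/-- the transport excess is geometric in the level: `ε_j = (Lʲ/Lᵏ)·ε_k` (print's «L^{j+1}ηα₁»). [cite: Balaban1985Averaging, Proposition 7 p.43] -/
theorem epsCplx_level {L : ℕ} (hL : 1 ≤ L) (b' : ℝ) (k j : ℕ) :
    epsCplx d L b' j = ((L : ℝ) ^ j * ((L : ℝ) ^ k)⁻¹) * epsCplx d L b' k := by
  have hLk : (L : ℝ) ^ k ≠ 0 := pow_ne_zero k (by exact_mod_cast (by omega : L ≠ 0))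
  unfold epsCplx
  field_simp

/-- the `Q″`-coefficient is dominated geometrically: `τ_j ≤ (Lʲ/Lᵏ)·τ_k` for `j ≤ k` (the `α₀`-part carries `(Lʲ/Lᵏ)² ≤ Lʲ/Lᵏ`).
[cite: Balaban1985Averaging, Proposition 7 p.43, (144) p.40] -/
theorem tauCplx_level_le {L : ℕ} (hL : 1 ≤ L) {α₀ : ℝ} (hα : 0 ≤ α₀) {b' : ℝ} (hb' : 0 ≤ b') {k j : ℕ} (hj : j ≤ k) :
    tauCplx d L α₀ k b' j ≤ ((L : ℝ) ^ j * ((L : ℝ) ^ k)⁻¹) * tauCplx d L α₀ k b' k := by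
  have hL0 : (0 : ℝ) < L := by exact_mod_cast hL
  have hL1 : (1 : ℝ) ≤ L := by exact_mod_cast hL
  have hLk : (0 : ℝ) < (L : ℝ) ^ k := by positivity
  set r : ℝ := (L : ℝ) ^ j * ((L : ℝ) ^ k)⁻¹ with hr
  have hr0 : 0 ≤ r := by positivity
  have hr1 : r ≤ 1 := by
    rw [hr, mul_inv_le_iff₀ hLk, one_mul]; exact pow_le_pow_right₀ hL1 hj
  have hrk : (L : ℝ) ^ k * ((L : ℝ) ^ k)⁻¹ = 1 := mul_inv_cancel₀ hLk.ne'
  have hjb : (L : ℝ) ^ j * b' = r * ((L : ℝ) ^ k * b') := by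
    rw [hr]; field_simp
  unfold tauCplx
  rw [hrk, hjb, one_pow, mul_one]
  have hr2 : r ^ 2 ≤ r * 1 := by nlinarith
  have hA : 0 ≤ 140 * (32 * ((d : ℝ) + 1) * ((d : ℝ) + 4) * (L : ℝ) ^ 2 * α₀) := by positivity
  have hB : 0 ≤ 280 * (((2 * (d * L) + L + L : ℕ) : ℝ) * (400 * ((d : ℝ) + 1) * ((L : ℝ) ^ k * b'))) := by positivity
  have hC : 0 ≤ (L : ℝ) ^ d * (L : ℝ)⁻¹ := by positivity
  have key : 140 * (32 * ((d : ℝ) + 1) * ((d : ℝ) + 4) * (L : ℝ) ^ 2 * (α₀ * r ^ 2))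
        + 280 * (((2 * (d * L) + L + L : ℕ) : ℝ) * (400 * ((d : ℝ) + 1) * (r * ((L : ℝ) ^ k * b'))))
      ≤ r * (140 * (32 * ((d : ℝ) + 1) * ((d : ℝ) + 4) * (L : ℝ) ^ 2 * α₀)
        + 280 * (((2 * (d * L) + L + L : ℕ) : ℝ) * (400 * ((d : ℝ) + 1) * ((L : ℝ) ^ k * b')))) := by
    have h1 := mul_le_mul_of_nonneg_left hr2 hA
    nlinarith
  calc (140 * (32 * ((d : ℝ) + 1) * ((d : ℝ) + 4) * (L : ℝ) ^ 2 * (α₀ * r ^ 2))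
        + 280 * (((2 * (d * L) + L + L : ℕ) : ℝ) * (400 * ((d : ℝ) + 1) * (r * ((L : ℝ) ^ k * b')))))
        * (L : ℝ) ^ d * (L : ℝ)⁻¹
      = (140 * (32 * ((d : ℝ) + 1) * ((d : ℝ) + 4) * (L : ℝ) ^ 2 * (α₀ * r ^ 2))
        + 280 * (((2 * (d * L) + L + L : ℕ) : ℝ) * (400 * ((d : ℝ) + 1) * (r * ((L : ℝ) ^ k * b')))))
        * ((L : ℝ) ^ d * (L : ℝ)⁻¹) := by ring
    _ ≤ (r * (140 * (32 * ((d : ℝ) + 1) * ((d : ℝ) + 4) * (L : ℝ) ^ 2 * α₀)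
        + 280 * (((2 * (d * L) + L + L : ℕ) : ℝ) * (400 * ((d : ℝ) + 1) * ((L : ℝ) ^ k * b')))))
        * ((L : ℝ) ^ d * (L : ℝ)⁻¹) := mul_le_mul_of_nonneg_right key hC
    _ = _ := by ring

/-! ## §2 The step conditions (145)ⱼ, (155)ⱼ from the smallness -/

/-- **(145)ⱼ AT THE COMPLEX BACKGROUND FROM THE SMALLNESS** — print's «this change is easily incorporated into the considerations
and the estimates»: with `Θ = 8(E + T)·r`, `ε = rE`, `τ ≤ rT`, `r ≤ 1`, `E ≤ 1/16`, `d(E + T) ≤ 1/16`, `L ≥ 2`: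
`(1 + ε)Θ(2L−1) + εL + τL(1 + 2dΘ) ≤ Θ·L·L` (elementary: `19L − 17/2 ≤ 8L²` for `L ≥ 2`). [cite: Balaban1985Averaging, (145) p.40, Proposition 7 p.43] -/
theorem step143_arith {L E T d r τ : ℝ} (hL : 2 ≤ L) (hE0 : 0 ≤ E) (hT0 : 0 ≤ T) (hd : 0 ≤ d) (hr0 : 0 ≤ r) (hr1 : r ≤ 1)
    (hτ0 : 0 ≤ τ) (hτ : τ ≤ r * T) (hE : E ≤ 1 / 16) (hdX : d * (E + T) ≤ 1 / 16) :
    (1 + r * E) * (8 * (E + T) * r) * (2 * L - 1) + r * E * L + τ * L * (1 + 2 * d * (8 * (E + T) * r))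
      ≤ 8 * (E + T) * (r * L) * L := by
  set X := E + T with hX
  have hX0 : 0 ≤ X := by positivity
  have hL0 : 0 ≤ L := by linarith
  have h2L : 0 ≤ 2 * L - 1 := by linarith
  have hrE : r * E ≤ 1 / 16 := by nlinarith
  -- term 1: `(1 + rE)·8Xr·(2L−1) ≤ (17/2)·Xr·(2L−1)`
  have h1 : (1 + r * E) * (8 * X * r) * (2 * L - 1) ≤ r * (17 / 2 * X * (2 * L - 1)) := by
    have h8 : 0 ≤ 8 * X * r * (2 * L - 1) := by positivity
    calc (1 + r * E) * (8 * X * r) * (2 * L - 1) = (1 + r * E) * (8 * X * r * (2 * L - 1)) := by ring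
      _ ≤ (17 / 16) * (8 * X * r * (2 * L - 1)) := mul_le_mul_of_nonneg_right (by linarith) h8
      _ = r * (17 / 2 * X * (2 * L - 1)) := by ring
  -- term 3: `τL(1 + 16dXr) ≤ 2rTL`
  have hin : 1 + 2 * d * (8 * X * r) ≤ 2 := by
    have : d * X * r ≤ 1 / 16 := by
      calc d * X * r ≤ d * X * 1 := mul_le_mul_of_nonneg_left hr1 (by positivity)
        _ = d * (E + T) := by rw [hX]; ring
        _ ≤ 1 / 16 := hdX
    nlinarith
  have h3 : τ * L * (1 + 2 * d * (8 * X * r)) ≤ r * (2 * T * L) := by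
    calc τ * L * (1 + 2 * d * (8 * X * r)) ≤ τ * L * 2 := mul_le_mul_of_nonneg_left hin (by positivity)
      _ ≤ r * T * L * 2 := by nlinarith [mul_le_mul_of_nonneg_right hτ hL0]
      _ = r * (2 * T * L) := by ring
  -- term 2: `rEL ≤ rXL`
  have h2 : r * E * L ≤ r * (X * L) := by
    have : E ≤ X := by rw [hX]; linarith
    nlinarith [mul_nonneg hr0 hL0]
  -- sum and compare with `8XrL²`: `(17/2)(2L−1) + 3L ≤ 8L²` … in fact `E·L + 2T·L ≤ 2X·L`
  have h23 : r * E * L + τ * L * (1 + 2 * d * (8 * X * r)) ≤ r * (2 * X * L) := by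
    have : E * L + 2 * T * L ≤ 2 * X * L := by rw [hX]; nlinarith
    nlinarith [mul_nonneg hr0 hL0]
  have hpoly : 17 / 2 * (2 * L - 1) + 2 * L ≤ 8 * (L * L) := by nlinarith [sq_nonneg (L - 2)]
  have hfin : r * (17 / 2 * X * (2 * L - 1)) + r * (2 * X * L) ≤ 8 * X * (r * L) * L := by
    have := mul_le_mul_of_nonneg_left hpoly (mul_nonneg hr0 hX0)
    nlinarith
  linarith

/-- **(155)ⱼ AT THE COMPLEX BACKGROUND FROM THE SMALLNESS** — print's «This inequality is satisfied if C₃ > C″₁ and α₀, α₁ are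
sufficiently small»: with `2C″/C₃ = 1/8`, `Θ = 8(E+T)r`, `ε = rE`, `τ ≤ rT`, `r ≤ 1`, `E ≤ 1/16`, `d(E+T) ≤ 1/16`, `dC₃β ≤ 1`,
`L ≥ 2`: `(1 + ε)(2L−1) + 2dτL + (1/8)(1 + 2dΘ + 2dC₃β) ≤ L²` (elementary: `(9/4)L − 9/16 ≤ L²` for `L ≥ 2`).
[cite: Balaban1985Averaging, (155) p.41, Proposition 7 p.43] -/
theorem step149_arith {L E T d r τ C₃ β : ℝ} (hL : 2 ≤ L) (hE0 : 0 ≤ E) (hT0 : 0 ≤ T) (hd : 0 ≤ d)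
    (hr1 : r ≤ 1) (hτ : τ ≤ r * T) (hE : E ≤ 1 / 16) (hdX : d * (E + T) ≤ 1 / 16) (hβ : d * C₃ * β ≤ 1) :
    (1 + r * E) * (2 * L - 1) + 2 * d * τ * L + 1 / 8 * (1 + 2 * d * (8 * (E + T) * r) + 2 * d * C₃ * β) ≤ L ^ 2 := by
  set X := E + T with hX
  have hX0 : 0 ≤ X := by positivity
  have hL0 : 0 ≤ L := by linarith
  have h2L : 0 ≤ 2 * L - 1 := by linarith
  have hrE : r * E ≤ 1 / 16 := by nlinarith
  have h1 : (1 + r * E) * (2 * L - 1) ≤ 17 / 16 * (2 * L - 1) := mul_le_mul_of_nonneg_right (by linarith) h2L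
  have hdT : d * T ≤ 1 / 16 := by
    have : d * T ≤ d * X := mul_le_mul_of_nonneg_left (by rw [hX]; linarith) hd
    linarith
  have h2 : 2 * d * τ * L ≤ 1 / 8 * L := by
    have hτ' : τ ≤ T := hτ.trans (by nlinarith)
    have : d * τ ≤ 1 / 16 := (mul_le_mul_of_nonneg_left hτ' hd).trans hdT
    nlinarith
  have h3 : 1 / 8 * (1 + 2 * d * (8 * X * r) + 2 * d * C₃ * β) ≤ 1 / 2 := by
    have : d * X * r ≤ 1 / 16 := by
      calc d * X * r ≤ d * X * 1 := mul_le_mul_of_nonneg_left hr1 (by positivity)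
        _ = d * (E + T) := by rw [hX]; ring
        _ ≤ 1 / 16 := hdX
    nlinarith
  have hpoly : 17 / 16 * (2 * L - 1) + 1 / 8 * L + 1 / 2 ≤ L ^ 2 := by nlinarith [sq_nonneg (L - 2)]
  linarith

/-! ## §3 Proposition 5 at `U′U₀`, per bond, k-uniform, uniformly in `U′` -/

section Regime

variable {𝔸 : Type*} [NormedRing 𝔸] [NormedAlgebra ℂ 𝔸] [CompleteSpace 𝔸] [NormOneClass 𝔸]

variable (L : ℕ) (hL : 2 ≤ L) {G : Subgroup 𝔸ˣ} (hG : AvgClosed d L G) (k : ℕ)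
  (U₀ : Site d → Fin d → 𝔸ˣ) (hU₀ : ∀ x κ, U₀ x κ ∈ G) {α₀ : ℝ} (hα : 0 < α₀)
  (hα3 : C0 d * α₀ ≤ 1 / 3) (hα8 : 8 * α₀ ≤ c2' d L) (h52 : pdev U₀ < α₀ * (((L : ℝ) ^ k)⁻¹) ^ 2)
  (B' : Site d → Fin d → 𝔸) {b' : ℝ} (hb' : 0 ≤ b') (hB' : ∀ x κ, ‖B' x κ‖ ≤ b')
  (hsmall' : Real.exp (4 * (800 * ((d : ℝ) + 1) ^ 2 * ((d : ℝ) + 4)) * α₀)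
    * (1 + 8 * (131072 * ((d : ℝ) + 1) ^ 2) * ((L : ℝ) ^ k * b')) ≤ 2)
  (hc₃' : 2 * ((L : ℝ) ^ k * b') ≤ c3 d L) (hb'1 : 409600 * ((d : ℝ) + 1) ^ 2 * ((L : ℝ) ^ k * b') ≤ 1)
  (hE : epsCplx d L b' k ≤ 1 / 16) (hdX : (d : ℝ) * (epsCplx d L b' k + tauCplx d L α₀ k b' k) ≤ 1 / 16)

omit [NormedRing 𝔸] [NormedAlgebra ℂ 𝔸] [CompleteSpace 𝔸] [NormOneClass 𝔸] in
include hL in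
/-- level ratios: `Lʲ/Lᵏ ≤ 1` for `j ≤ k`, and `L^{j+1}/Lᵏ = L·(Lʲ/Lᵏ)`. [folklore] -/
private theorem ratio_facts {j : ℕ} (hj : j ≤ k) :
    0 ≤ (L : ℝ) ^ j * ((L : ℝ) ^ k)⁻¹ ∧ (L : ℝ) ^ j * ((L : ℝ) ^ k)⁻¹ ≤ 1 ∧
      (L : ℝ) ^ (j + 1) * ((L : ℝ) ^ k)⁻¹ = (L : ℝ) ^ j * ((L : ℝ) ^ k)⁻¹ * (L : ℝ) := by
  have hL1 : (1 : ℝ) ≤ L := by exact_mod_cast le_trans (by norm_num) hL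
  have hLk : (0 : ℝ) < (L : ℝ) ^ k := by positivity
  refine ⟨by positivity, ?_, by rw [pow_succ]; ring⟩
  rw [mul_inv_le_iff₀ hLk, one_mul]; exact pow_le_pow_right₀ hL1 hj

omit [NormedRing 𝔸] [NormedAlgebra ℂ 𝔸] [CompleteSpace 𝔸] [NormOneClass 𝔸] in
include hL hα hb' hE hdX in
/-- **(145)ⱼ for every `j < k` at the complex background** with `ε_j = epsCplx … j`, `τ_j = tauCplx … j`, `Θ_j = ϑ·Lʲ/Lᵏ` — the
binder `hstep` of `B7Prop5CplxLinear.ineq143_cplx` / `hstep143` of `B7Prop5CplxInduction.ineq149_cplx`. [cite: Balaban1985Averaging, (145) p.40, Proposition 7 p.43] -/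
theorem hstep143_cplx_levels : ∀ j < k,
    (1 + epsCplx d L b' j) * (thetaCplx d L α₀ k b' * ((L : ℝ) ^ j * ((L : ℝ) ^ k)⁻¹)) * (2 * (L : ℝ) - 1)
      + epsCplx d L b' j * (L : ℝ)
      + tauCplx d L α₀ k b' j * (L : ℝ) * (1 + 2 * d * (thetaCplx d L α₀ k b' * ((L : ℝ) ^ j * ((L : ℝ) ^ k)⁻¹)))
      ≤ thetaCplx d L α₀ k b' * ((L : ℝ) ^ (j + 1) * ((L : ℝ) ^ k)⁻¹) * (L : ℝ) := by
  intro j hj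
  have hL1 : 1 ≤ L := le_trans (by norm_num) hL
  have hLr : (2 : ℝ) ≤ L := by exact_mod_cast hL
  obtain ⟨hr0, hr1, hsucc⟩ := ratio_facts L hL k hj.le
  set r : ℝ := (L : ℝ) ^ j * ((L : ℝ) ^ k)⁻¹ with hr
  have heps : epsCplx d L b' j = r * epsCplx d L b' k := epsCplx_level hL1 b' k j
  have htau : tauCplx d L α₀ k b' j ≤ r * tauCplx d L α₀ k b' k := tauCplx_level_le hL1 hα.le hb' hj.le
  have h := step143_arith (d := (d : ℝ)) hLr (epsCplx_nonneg d L hb' k) (tauCplx_nonneg d L hα.le k hb' k) (Nat.cast_nonneg d)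
    hr0 hr1 (tauCplx_nonneg d L hα.le k hb' j) htau hE hdX
  rw [hsucc, heps, thetaCplx]
  refine le_trans (le_of_eq ?_) (h.trans (le_of_eq ?_)) <;> ring

omit [NormedRing 𝔸] [NormedAlgebra ℂ 𝔸] [CompleteSpace 𝔸] [NormOneClass 𝔸] in
include hL hα hb' hE hdX in
/-- **(155)ⱼ for every `j < k` at the complex background** with `2C″/C₃ = 1/8` (`C₃ = C3Cplx = 16·C1ppCplx`) under `d·C₃·Lᵏb ≤ 1`
— the binder `hstep149` of `B7Prop5CplxInduction.ineq149_cplx`. [cite: Balaban1985Averaging, (155) p.41, Proposition 7 p.43] -/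
theorem hstep149_cplx_levels {b : ℝ} (hβ : (d : ℝ) * C3Cplx d L * ((L : ℝ) ^ k * b) ≤ 1) : ∀ j < k,
    (1 + epsCplx d L b' j) * (2 * (L : ℝ) - 1) + 2 * d * tauCplx d L α₀ k b' j * (L : ℝ)
      + 2 * C1ppCplx d L / C3Cplx d L
        * (1 + 2 * d * (thetaCplx d L α₀ k b' * ((L : ℝ) ^ j * ((L : ℝ) ^ k)⁻¹)) + 2 * d * C3Cplx d L * ((L : ℝ) ^ k * b))
      ≤ (L : ℝ) ^ 2 := by
  intro j hj
  have hL1 : 1 ≤ L := le_trans (by norm_num) hL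
  have hLr : (2 : ℝ) ≤ L := by exact_mod_cast hL
  obtain ⟨-, hr1, -⟩ := ratio_facts L hL k hj.le
  set r : ℝ := (L : ℝ) ^ j * ((L : ℝ) ^ k)⁻¹ with hr
  have heps : epsCplx d L b' j = r * epsCplx d L b' k := epsCplx_level hL1 b' k j
  have htau : tauCplx d L α₀ k b' j ≤ r * tauCplx d L α₀ k b' k := tauCplx_level_le hL1 hα.le hb' hj.le
  have h := step149_arith (d := (d : ℝ)) (β := (L : ℝ) ^ k * b) hLr (epsCplx_nonneg d L hb' k)
    (tauCplx_nonneg d L hα.le k hb' k) (Nat.cast_nonneg d) hr1 htau hE hdX hβ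
  rw [two_mul_C1ppCplx_div_C3Cplx d hL1, heps, thetaCplx]
  refine le_trans (le_of_eq ?_) h
  ring

include hL hG hU₀ hα hα3 hα8 h52 hb' hB' hsmall' hc₃' hb'1 hE hdX in
/-- **(147) AT THE COMPLEX BACKGROUND `U′U₀`, PER BOND, k-UNIFORM, UNIFORMLY IN `U′`** «|Q_k(U′U₀; c, b)| ≦ 1 + 2C′₁α₀»: for every
`j ≤ k`, every unit-lattice bond `b = ⟨y, y + e_μ⟩`, `X ∈ 𝔸` and every bond `c = ⟨z, z + e_κ⟩` of the `j`-th lattice,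
`‖LʲηQ_j(U′U₀)(Xδ_b)(c)‖ ≤ (1 + ϑ·Lʲ/Lᵏ)·Lʲ·L^{−jd}·‖X‖` (`ϑ = thetaCplx d L α₀ k b′`, depending on `b′` but not on `B′`), and it
VANISHES unless `b ⊂ Bʲ(c₋) ∪ Bʲ(c₊)` — `B7Prop5CplxLinear.ineq147_cplx` / `linCovIter_bump_eq_zero_cplx` with the level binders of
`B7Prop5CplxLevels` and §2. [cite: Balaban1985Averaging, (146)–(147) p.40, Proposition 7 p.43] -/
theorem prop5_cplx_147_uniform (y : Site d) (μ : Fin d) (X : 𝔸) {j : ℕ} (hj : j ≤ k) (z : Site d) (κ : Fin d) :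
    ‖linCovIter L (expCfg B' * U₀) (bump y μ X) j z κ‖ ≤
        (1 + thetaCplx d L α₀ k b' * ((L : ℝ) ^ j * ((L : ℝ) ^ k)⁻¹)) * ((L : ℝ) ^ j * (((L : ℝ) ^ j) ^ d)⁻¹) * ‖X‖ ∧
      (¬ BondIn (loK L j z) (bondHiK L j z κ) y μ → linCovIter L (expCfg B' * U₀) (bump y μ X) j z κ = 0) := by
  have hΘ : ∀ j, 0 ≤ thetaCplx d L α₀ k b' * ((L : ℝ) ^ j * ((L : ℝ) ^ k)⁻¹) :=
    fun j => mul_nonneg (thetaCplx_nonneg d L hα.le k hb') (by positivity)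
  exact ⟨ineq147_cplx L hL (expCfg B' * U₀) k (fun j => epsCplx_nonneg d L hb' j)
      (fun j => tauCplx_nonneg d L hα.le k hb' j) hΘ
      (h139_cplx_levels L hL hG k U₀ hU₀ hα hα3 hα8 h52 B' hb' hB' hsmall' hc₃' hb'1)
      (hstep143_cplx_levels L hL k hα hb' hE hdX) y μ X hj z κ,
    linCovIter_bump_eq_zero_cplx L hL (expCfg B' * U₀) k (fun j => epsCplx_nonneg d L hb' j)
      (fun j => tauCplx_nonneg d L hα.le k hb' j) hΘ
      (h139_cplx_levels L hL hG k U₀ hU₀ hα hα3 hα8 h52 B' hb' hB' hsmall' hc₃' hb'1)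
      (hstep143_cplx_levels L hL k hα hb' hE hdX) y μ X hj z κ⟩

variable (B : Site d → Fin d → 𝔸) {b : ℝ} (hb : 0 ≤ b) (hB : ∀ x κ, ‖B x κ‖ ≤ b)
  (hsmall : Real.exp (4480 * ((d : ℝ) + 1) ^ 2 * ((d : ℝ) + 4) * α₀ + 240000 * ((d : ℝ) + 1) ^ 3 * ((L : ℝ) ^ k * b'))
    * (1 + 8 * (2097152 * ((d : ℝ) + 1) ^ 2) * ((L : ℝ) ^ k * b)) ≤ 2)
  (hc₃ : 16 * ((L : ℝ) ^ k * b) < c3 d L) (hβ : (d : ℝ) * C3Cplx d L * ((L : ℝ) ^ k * b) ≤ 1)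

include hL hG hU₀ hα hα3 hα8 h52 hb' hB' hsmall' hc₃' hb'1 hE hdX hb hB hsmall hc₃ hβ in
/-- **PROPOSITION 5 (157) AT THE COMPLEX BACKGROUND `U′U₀`, PER BOND, k-UNIFORM, UNIFORMLY IN `U′`** «|(δ/δA_b)C_k(U′U₀, A, c)| ≦
C₃|A|»: for every `j ≤ k`, every unit-lattice bond `b = ⟨y, y + e_μ⟩`, `X ∈ 𝔸` and every bond `c` of the `j`-th lattice,
`B″ ↦ C_j(U′U₀, B″)(c)` (`logCovIter − linCovIter` at `W = e^{B′}U₀`) is differentiable at `B` in the direction `X·δ_b` ((137),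
`t ∈ ℂ`) with `‖dC_j(B; Xδ_b)(c)‖ ≤ C₃·(Lʲ)²·L^{−jd}·b·‖X‖` (`C₃ = C3Cplx d L`, independent of `U′`, `j`, `k`; at `j = k`, `B = ηA`:
`C₃|A|·η^d·‖X‖`), and the derivative VANISHES unless `b ⊂ Bʲ(c₋) ∪ Bʲ(c₊)` — `B7Prop5CplxInduction.prop5_cplx_157` with every
one-step binder discharged by `B7Prop5CplxLevels` and the step conditions of §2.
[cite: Balaban1985Averaging, Prop. 5 (157) p.42, (149)–(155) pp.40–41, Proposition 7 p.43] -/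
theorem prop5_cplx_157_uniform (y : Site d) (μ : Fin d) (X : 𝔸) {j : ℕ} (hj : j ≤ k) (z : Site d) (κ : Fin d) :
    HasLineDerivAt ℂ (fun B'' => CCovIter L (expCfg B' * U₀) B'' j z κ)
        (dCov L (expCfg B' * U₀) B (bump y μ X) j z κ) B (bump y μ X) ∧
      ‖dCov L (expCfg B' * U₀) B (bump y μ X) j z κ‖
          ≤ C3Cplx d L * ((L : ℝ) ^ j) ^ 2 * (((L : ℝ) ^ j) ^ d)⁻¹ * b * ‖X‖ ∧
      (¬ BondIn (loK L j z) (bondHiK L j z κ) y μ → dCov L (expCfg B' * U₀) B (bump y μ X) j z κ = 0) := by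
  have hL1 : 1 ≤ L := le_trans (by norm_num) hL
  have hΘ : ∀ j, 0 ≤ thetaCplx d L α₀ k b' * ((L : ℝ) ^ j * ((L : ℝ) ^ k)⁻¹) :=
    fun j => mul_nonneg (thetaCplx_nonneg d L hα.le k hb') (by positivity)
  exact B7Prop5CplxInduction.prop5_cplx_157 L hL (expCfg B' * U₀) k (fun j => epsCplx_nonneg d L hb' j)
    (fun j => tauCplx_nonneg d L hα.le k hb' j) hΘ (C1ppCplx_pos d hL1).le (C3Cplx_pos d hL1) hb
    (hadd_cplx_levels L hL hG k U₀ hU₀ hα hα3 hα8 h52 B' hb' hB' hsmall' hc₃' hb'1)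
    (hsmul_cplx_levels L hL hG k U₀ hU₀ hα hα3 hα8 h52 B' hb' hB' hsmall' hc₃' hb'1)
    (h139_cplx_levels L hL hG k U₀ hU₀ hα hα3 hα8 h52 B' hb' hB' hsmall' hc₃' hb'1)
    (hstep143_cplx_levels L hL k hα hb' hE hdX) (hloc_cplx_levels L hL k U₀ B')
    (h148_cplx_levels L hL hG k U₀ hU₀ hα hα3 hα8 h52 B' hb' hB' hsmall' hc₃' hb'1)
    (hdiff_cplx_levels L hL hG k U₀ hU₀ hα hα3 hα8 h52 B' hb' hB' hsmall' hc₃' hb'1) B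
    (h131_cplx_levels L hL hG k U₀ hU₀ hα hα3 hα8 h52 B' hb' hB' hsmall' hc₃' hb'1 B hb hB hsmall hc₃)
    (hrho_cplx_levels L hL k hb hc₃) (hstep149_cplx_levels L hL k hα hb' hE hdX hβ) y μ X hj z κ

include hL hG hU₀ hα hα3 hα8 h52 hb' hB' hsmall' hc₃' hb'1 hE hdX hb hB hsmall hc₃ hβ in
/-- **PROPOSITION 5 (156) AT THE COMPLEX BACKGROUND `U′U₀`, PER BOND, k-UNIFORM, UNIFORMLY IN `U′`** «|(δ/δA_b)Q_k(U′U₀, ηA, c)| ≦ 1 +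
2C′₁α₀ + C₃|A|»: the composite `B″ ↦ Q_j(U′U₀, ηB″)(c)` (`logCovIter` at `W = e^{B′}U₀`, (127)) is differentiable at `B` in the direction
`X·δ_b` with derivative `dC_j(B; Xδ_b)(c) + LʲηQ_j(U′U₀)(Xδ_b)(c)` of norm `≤ ((1 + ϑ·Lʲ/Lᵏ)·Lʲ + C₃·(Lʲ)²·b)·L^{−jd}·‖X‖` (`ϑ =
thetaCplx d L α₀ k b′`, `C₃ = C3Cplx d L` — independent of `U′`, `j`, `k`) — (147) + (157) via (134): Proposition 5 «extended to include
… uniformity statements». [cite: Balaban1985Averaging, Prop. 5 (156) p.42, (134) p.38, Proposition 7 p.43] -/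
theorem prop5_cplx_156_uniform (y : Site d) (μ : Fin d) (X : 𝔸) {j : ℕ} (hj : j ≤ k) (z : Site d) (κ : Fin d) :
    HasLineDerivAt ℂ (fun B'' => logCovIter L (expCfg B' * U₀) B'' j z κ)
        (dCov L (expCfg B' * U₀) B (bump y μ X) j z κ + linCovIter L (expCfg B' * U₀) (bump y μ X) j z κ) B (bump y μ X) ∧
      ‖dCov L (expCfg B' * U₀) B (bump y μ X) j z κ + linCovIter L (expCfg B' * U₀) (bump y μ X) j z κ‖ ≤
        ((1 + thetaCplx d L α₀ k b' * ((L : ℝ) ^ j * ((L : ℝ) ^ k)⁻¹)) * (L : ℝ) ^ j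
            + C3Cplx d L * ((L : ℝ) ^ j) ^ 2 * b) * (((L : ℝ) ^ j) ^ d)⁻¹ * ‖X‖ := by
  have hL1 : 1 ≤ L := le_trans (by norm_num) hL
  have hΘ : ∀ j, 0 ≤ thetaCplx d L α₀ k b' * ((L : ℝ) ^ j * ((L : ℝ) ^ k)⁻¹) :=
    fun j => mul_nonneg (thetaCplx_nonneg d L hα.le k hb') (by positivity)
  exact B7Prop5CplxInduction.prop5_cplx_156 L hL (expCfg B' * U₀) k (fun j => epsCplx_nonneg d L hb' j)
    (fun j => tauCplx_nonneg d L hα.le k hb' j) hΘ (C1ppCplx_pos d hL1).le (C3Cplx_pos d hL1) hb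
    (hadd_cplx_levels L hL hG k U₀ hU₀ hα hα3 hα8 h52 B' hb' hB' hsmall' hc₃' hb'1)
    (hsmul_cplx_levels L hL hG k U₀ hU₀ hα hα3 hα8 h52 B' hb' hB' hsmall' hc₃' hb'1)
    (h139_cplx_levels L hL hG k U₀ hU₀ hα hα3 hα8 h52 B' hb' hB' hsmall' hc₃' hb'1)
    (hstep143_cplx_levels L hL k hα hb' hE hdX) (hloc_cplx_levels L hL k U₀ B')
    (h148_cplx_levels L hL hG k U₀ hU₀ hα hα3 hα8 h52 B' hb' hB' hsmall' hc₃' hb'1)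
    (hdiff_cplx_levels L hL hG k U₀ hU₀ hα hα3 hα8 h52 B' hb' hB' hsmall' hc₃' hb'1) B
    (h131_cplx_levels L hL hG k U₀ hU₀ hα hα3 hα8 h52 B' hb' hB' hsmall' hc₃' hb'1 B hb hB hsmall hc₃)
    (hrho_cplx_levels L hL k hb hc₃) (hstep149_cplx_levels L hL k hα hb' hE hdX hβ) y μ X hj z κ


/-! ## §4 Proposition 5 at `U′U₀` at `j = k` IN THE PRINTED VARIABLES `A`, `η = L^{−k}` -/

variable (A : Site d → Fin d → 𝔸) {a : ℝ} (ha : 0 ≤ a) (hA : ∀ x κ, ‖A x κ‖ ≤ a)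
  (hsmallA : Real.exp (4480 * ((d : ℝ) + 1) ^ 2 * ((d : ℝ) + 4) * α₀ + 240000 * ((d : ℝ) + 1) ^ 3 * ((L : ℝ) ^ k * b'))
    * (1 + 8 * (2097152 * ((d : ℝ) + 1) ^ 2) * a) ≤ 2)
  (hc₃A : 16 * a < c3 d L) (hβA : (d : ℝ) * C3Cplx d L * a ≤ 1)

omit [CompleteSpace 𝔸] [NormOneClass 𝔸] in
include hL hA in
/-- the rescaled field `B = ηA` has `|B| ≤ ηa` and `Lᵏ·(ηa) = a`. [folklore] -/
private theorem rescale_bounds :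
    (∀ x κ', ‖((((L : ℝ) ^ k)⁻¹) • A) x κ'‖ ≤ ((L : ℝ) ^ k)⁻¹ * a) ∧
      (L : ℝ) ^ k * (((L : ℝ) ^ k)⁻¹ * a) = a := by
  have hL0 : (0 : ℝ) < L := by exact_mod_cast lt_of_lt_of_le (by norm_num) hL
  have hLk : (L : ℝ) ^ k ≠ 0 := by positivity
  have hη0 : 0 ≤ ((L : ℝ) ^ k)⁻¹ := by positivity
  refine ⟨fun x κ' => ?_, by rw [← mul_assoc, mul_inv_cancel₀ hLk, one_mul]⟩
  rw [Pi.smul_apply, Pi.smul_apply, norm_real_smul _ hη0]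
  exact mul_le_mul_of_nonneg_left (hA x κ') hη0

include hL hG hU₀ hα hα3 hα8 h52 hb' hB' hsmall' hc₃' hb'1 hE hdX ha hA hsmallA hc₃A hβA in
/-- **PROPOSITION 5 (157) AT `U′U₀` IN THE PRINTED VARIABLES, UNIFORMLY IN `U′`.**  p. 42/43: «|(δ/δA_b)C_k(U₀, A, c)| ≦ C₃|A| < C₃α₁
(157)» extended to `U′U₀`: `A` a field on the `η = L^{−k}`-lattice (sites labelled by `ℤᵈ`) with `|A| = sup_b|A_b| ≤ a`, `C_k(U′U₀,
A)(c) = Q_k(U′U₀, ηA)(c) − (Q_k(U′U₀)A)(c)` (134) (`= CCovIter L (e^{B′}U₀) (ηA) k`, `Lᵏη = 1`), derivative in the single-bond direction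
`X·δ_b`, `b = ⟨y, y + e_μ⟩` ((137), `t ∈ ℂ`): it exists, `|dC_k(U′U₀, A; Xδ_b)(c)| ≤ C₃|A|·η^d|X|` — i.e. `|(δ/δA_b)C_k(U′U₀, A, c)| ≦
C₃|A|` in the normalisation (138), `C₃ = C3Cplx d L` independent of `U′` — and it VANISHES unless `b ⊂ Bᵏ(c₋) ∪ Bᵏ(c₊)`
(`B7Prop5General.prop5_general_157_printed` is the case `U′ = 1`). [cite: Balaban1985Averaging, Prop. 5 (157) p.42, Proposition 7 p.43, (134) p.38, (137)–(138) p.39] -/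
theorem prop5_cplx_157_printed (y : Site d) (μ : Fin d) (X : 𝔸) (z : Site d) (κ : Fin d) :
    HasLineDerivAt ℂ (fun A'' => CCovIter L (expCfg B' * U₀) ((((L : ℝ) ^ k)⁻¹) • A'') k z κ)
        (dCov L (expCfg B' * U₀) ((((L : ℝ) ^ k)⁻¹) • A) (bump y μ ((((L : ℝ) ^ k)⁻¹) • X)) k z κ) A (bump y μ X) ∧
      ‖dCov L (expCfg B' * U₀) ((((L : ℝ) ^ k)⁻¹) • A) (bump y μ ((((L : ℝ) ^ k)⁻¹) • X)) k z κ‖ ≤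
        C3Cplx d L * a * ((((L : ℝ) ^ k)⁻¹) ^ d * ‖X‖) ∧
      (¬ BondIn (loK L k z) (bondHiK L k z κ) y μ →
        dCov L (expCfg B' * U₀) ((((L : ℝ) ^ k)⁻¹) • A) (bump y μ ((((L : ℝ) ^ k)⁻¹) • X)) k z κ = 0) := by
  set η : ℝ := ((L : ℝ) ^ k)⁻¹ with hη
  have hη0 : 0 < η := by positivity
  have hLη : (L : ℝ) ^ k * η = 1 := mul_inv_cancel₀ (by positivity)
  obtain ⟨hB, hLkb⟩ := rescale_bounds L hL k A hA
  have hsmall : Real.exp (4480 * ((d : ℝ) + 1) ^ 2 * ((d : ℝ) + 4) * α₀ + 240000 * ((d : ℝ) + 1) ^ 3 * ((L : ℝ) ^ k * b'))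
      * (1 + 8 * (2097152 * ((d : ℝ) + 1) ^ 2) * ((L : ℝ) ^ k * (η * a))) ≤ 2 := by rw [hLkb]; exact hsmallA
  have hc₃ : 16 * ((L : ℝ) ^ k * (η * a)) < c3 d L := by rw [hLkb]; exact hc₃A
  have hβ : (d : ℝ) * C3Cplx d L * ((L : ℝ) ^ k * (η * a)) ≤ 1 := by rw [hLkb]; exact hβA
  obtain ⟨h1, h2, h3⟩ := prop5_cplx_157_uniform L hL hG k U₀ hU₀ hα hα3 hα8 h52 B' hb' hB' hsmall' hc₃' hb'1 hE hdX (η • A)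
    (by positivity) hB hsmall hc₃ hβ y μ (η • X) le_rfl z κ
  have e1 : (((L : ℝ) ^ k) ^ d)⁻¹ = η ^ d := by rw [hη, inv_pow]
  refine ⟨?_, h2.trans (le_of_eq ?_), h3⟩
  · have h1' : HasDerivAt (fun t : ℂ => CCovIter L (expCfg B' * U₀) (η • A + t • bump y μ (η • X)) k z κ)
        (dCov L (expCfg B' * U₀) (η • A) (bump y μ (η • X)) k z κ) 0 := h1
    show HasDerivAt (fun t : ℂ => CCovIter L (expCfg B' * U₀) (η • (A + t • bump y μ X)) k z κ) _ 0
    refine h1'.congr_of_eventuallyEq (Filter.Eventually.of_forall fun t => ?_)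
    simp only [smul_line, smul_bump]
  · rw [norm_real_smul η hη0.le, e1, ← hη]
    calc C3Cplx d L * ((L : ℝ) ^ k) ^ 2 * η ^ d * (η * a) * (η * ‖X‖)
        = C3Cplx d L * a * (η ^ d * ‖X‖) * ((L : ℝ) ^ k * η) ^ 2 := by ring
      _ = C3Cplx d L * a * (η ^ d * ‖X‖) := by rw [hLη]; ring

include hL hG hU₀ hα hα3 hα8 h52 hb' hB' hsmall' hc₃' hb'1 hE hdX ha hA hsmallA hc₃A hβA in
/-- **PROPOSITION 5 (156) AT `U′U₀` IN THE PRINTED VARIABLES, UNIFORMLY IN `U′` — «The formulations are obvious».**  p. 42/43: «|(δ/δA_b)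
Q_k(U₀, ηA, c)| ≦ 1 + 2C′₁α₀ + C₃|A| < 1 + 2C′₁α₀ + C₃α₁ (156)» extended to `U′U₀`: for `|A| ≤ a`, every bond `b = ⟨y, y + e_μ⟩`, `X ∈ 𝔸`,
every bond `c ⊂ Ω^{(k)}`, `A ↦ Q_k(U′U₀, ηA)(c)` (the composite (127), `logCovIter L (e^{B′}U₀) (ηA) k`) is differentiable in the direction
`X·δ_b` and `|dQ_k(U′U₀, ηA; Xδ_b)(c)| ≤ (1 + ϑ + C₃|A|)·η^d|X|` with `ϑ = thetaCplx d L α₀ k b′` (print's «2C′₁α₀», here `O(1)(α₀ +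
α₁)`, `α₁ = Lᵏb′` the size of `A′ = η⁻¹B′`) and `C₃ = C3Cplx d L`, both independent of `U′` — i.e. «|(δ/δA_b)Q_k(U′U₀, ηA, c)| ≦ 1 + ϑ +
C₃|A|» in the normalisation (138) (`B7Prop5General.prop5_general_156_printed` is the case `U′ = 1`).
[cite: Balaban1985Averaging, Prop. 5 (156) p.42, Proposition 7 p.43, (127) p.37, (137)–(138) p.39] -/
theorem prop5_cplx_156_printed (y : Site d) (μ : Fin d) (X : 𝔸) (z : Site d) (κ : Fin d) :
    LineDifferentiableAt ℂ (fun A'' => logCovIter L (expCfg B' * U₀) ((((L : ℝ) ^ k)⁻¹) • A'') k z κ) A (bump y μ X) ∧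
      ‖lineDeriv ℂ (fun A'' => logCovIter L (expCfg B' * U₀) ((((L : ℝ) ^ k)⁻¹) • A'') k z κ) A (bump y μ X)‖ ≤
        (1 + thetaCplx d L α₀ k b' + C3Cplx d L * a) * ((((L : ℝ) ^ k)⁻¹) ^ d * ‖X‖) := by
  set η : ℝ := ((L : ℝ) ^ k)⁻¹ with hη
  have hη0 : 0 < η := by positivity
  have hLη : (L : ℝ) ^ k * η = 1 := mul_inv_cancel₀ (by positivity)
  obtain ⟨hB, hLkb⟩ := rescale_bounds L hL k A hA
  have hsmall : Real.exp (4480 * ((d : ℝ) + 1) ^ 2 * ((d : ℝ) + 4) * α₀ + 240000 * ((d : ℝ) + 1) ^ 3 * ((L : ℝ) ^ k * b'))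
      * (1 + 8 * (2097152 * ((d : ℝ) + 1) ^ 2) * ((L : ℝ) ^ k * (η * a))) ≤ 2 := by rw [hLkb]; exact hsmallA
  have hc₃ : 16 * ((L : ℝ) ^ k * (η * a)) < c3 d L := by rw [hLkb]; exact hc₃A
  have hβ : (d : ℝ) * C3Cplx d L * ((L : ℝ) ^ k * (η * a)) ≤ 1 := by rw [hLkb]; exact hβA
  obtain ⟨h1, h2⟩ := prop5_cplx_156_uniform L hL hG k U₀ hU₀ hα hα3 hα8 h52 B' hb' hB' hsmall' hc₃' hb'1 hE hdX (η • A)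
    (by positivity) hB hsmall hc₃ hβ y μ (η • X) le_rfl z κ
  have h1' : HasDerivAt (fun t : ℂ => logCovIter L (expCfg B' * U₀) (η • A + t • bump y μ (η • X)) k z κ)
      (dCov L (expCfg B' * U₀) (η • A) (bump y μ (η • X)) k z κ + linCovIter L (expCfg B' * U₀) (bump y μ (η • X)) k z κ) 0 := h1
  have hA' : HasLineDerivAt ℂ (fun A'' => logCovIter L (expCfg B' * U₀) (η • A'') k z κ)
      (dCov L (expCfg B' * U₀) (η • A) (bump y μ (η • X)) k z κ + linCovIter L (expCfg B' * U₀) (bump y μ (η • X)) k z κ)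
      A (bump y μ X) := by
    show HasDerivAt (fun t : ℂ => logCovIter L (expCfg B' * U₀) (η • (A + t • bump y μ X)) k z κ) _ 0
    refine h1'.congr_of_eventuallyEq (Filter.Eventually.of_forall fun t => ?_)
    simp only [smul_line, smul_bump]
  refine ⟨hA'.lineDifferentiableAt, ?_⟩
  rw [hA'.lineDeriv]
  refine h2.trans (le_of_eq ?_)
  have e1 : (((L : ℝ) ^ k) ^ d)⁻¹ = η ^ d := by rw [hη, inv_pow]
  rw [norm_real_smul η hη0.le, e1, ← hη]
  calc ((1 + thetaCplx d L α₀ k b' * ((L : ℝ) ^ k * η)) * (L : ℝ) ^ k + C3Cplx d L * ((L : ℝ) ^ k) ^ 2 * (η * a))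
        * η ^ d * (η * ‖X‖)
      = ((1 + thetaCplx d L α₀ k b' * ((L : ℝ) ^ k * η)) * ((L : ℝ) ^ k * η)
          + C3Cplx d L * a * ((L : ℝ) ^ k * η) ^ 2) * (η ^ d * ‖X‖) := by ring
    _ = (1 + thetaCplx d L α₀ k b' + C3Cplx d L * a) * (η ^ d * ‖X‖) := by rw [hLη]; ring

end Regime

end Literature.MathematicalPhysics.QuantumFieldTheory.Balaban1983to89.B7Prop5Cplx

end
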